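import Summits.QuantumFields.YangMills.Theorems.IR.PurityChannelAnchorTransport
import Literature.MathematicalPhysics.QuantumFieldTheory.PeriodicBoxRooting
import Literature.MathematicalPhysics.QuantumFieldTheory.PeriodicBoxInclusion
import HarnessLib

/-!
# Crux `IR` (stmt-QuantumFields-19354) — purity-channel family: towards the located supplier `ComplexAnchor`
# Part 2: the periodic box with general rotation-covariant factors — the factor `nᵢ` and size-independence

Helper module for item `stmt-QuantumFields-19354` (`--supports … --as helper`; closes nothing, asserts nothing new).
Sequel of `PurityChannelAnchorTransport`: the two finite-size steps of the strong-coupling expansion of the free energy on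
a periodic box (Seiler LNP 159 Ch. 2–3), redone for GENERAL cell factors `f p : ZdGaugeConfig d G → ℂ` on the labels of the
box system `boxSystem ρ n` (only its bonds/adjacency are used):

* `sum_small_eq_size_mul_sum_boxRooted_of_covariant` (the tree's `sum_small_eq_size_mul_sum_boxRooted` for the Wilson
  weight): if `f` is a local perturbation of the Haar product under Dobrushin smallness and is covariant under the
  translations in the `i`-th coordinate, then for `2m ≤ nᵢ` the truncated functionals of the families of polymers of total
  size `< m` with a rotation-invariant property `Q` sum to `nᵢ` times the sum over the ROOTED ones (`BoxRooted i m`);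
* `sum_small_boxRooted_eq_of_le_of_compatible` (the tree's `sum_small_boxRooted_eq_of_le`): for sizes `n ≤ n'` agreeing
  outside `J`, `m + 1 ≤ nᵢ` (`i ∈ J`), and two factor families `f` (box `n`), `f'` (box `n'`) that AGREE ALONG THE INCLUSION
  `castLE` on the labels with `J`-coordinates `< m`, the rooted small-cluster sums of the two boxes coincide.

The geometric inputs (`exists_boxRooted_rotFamily`, `eq_of_rotFamily_eq_of_boxRooted`, `BoxLabel.bonds_castLE`, the
local-isomorphism bookkeeping of `PlaqSystemLocalIso`) are the tree's, verbatim; only the transport of `Φ^T` is the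
general-factor one of Part 1.  Everything is proved; no definitions; no named facts.

HONEST FRAMING: strong-coupling bookkeeping, group-blind; width 0 toward `IR` (19354); nothing here bears on confinement, a
lattice gap or the Yang–Mills mass gap (Clay), which are NOT proved; `R4` closes only `BalabanLadder.UV`.
-/

set_option autoImplicit false

noncomputable section

open MeasureTheory ProbabilityTheory Finset Filter
open Literature.Probability.LatticeModels
open Literature.MathematicalPhysics.QuantumFieldTheory

namespace Summit.QuantumFields.YangMills.Cruxes.IR.PurityChannelFamily

variable {d : ℕ} {n n' : Fin d → ℕ} {G : Type*} [Group G] {N : ℕ} {ρ : G →* Matrix (Fin N) (Fin N) ℂ}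
  [TopologicalSpace G] [IsTopologicalGroup G] [CompactSpace G] [MeasurableSpace G] [BorelSpace G]

/-! ## §1 Small clusters are the rotations of the rooted ones: the factor `nᵢ` -/

section SumIdentity

variable {f : BoxLabel n → ZdGaugeConfig d G → ℂ} {ε : ℝ} {𝓕 : BoxLabel n → MeasurableSpace (ZdGaugeConfig d G)}

open scoped Classical in
/-- **Translation invariance of the small-cluster sum: the factor `nᵢ`** (general rotation-covariant factors).  Let `f` be
a local perturbation of `zdHaar d G` for the adjacency of `boxSystem ρ n` with `e ε (16d²+1)² ≤ 1/2`, measurable, depending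
only on the bonds of each label, and covariant under the translations in the `i`-th coordinate.  Then for `2m ≤ nᵢ` and a
rotation-invariant property `Q`, the truncated functionals of the families of polymers of total size `< m` satisfying `Q`
sum to `nᵢ` times the sum over the rooted ones: `Φ^T` vanishes off nonempty clusters (Kotecký–Preiss), and the nonempty
small clusters are bijectively the `nᵢ` rotations of the rooted ones (`exists_boxRooted_rotFamily`,
`eq_of_rotFamily_eq_of_boxRooted`) with equal `Φ^T` (`truncatedWeight_rotFamily_of_covariant`).  [Seiler LNP 159 Ch. 2] -/
theorem sum_small_eq_size_mul_sum_boxRooted_of_covariant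
    (hLP : IsLocalPerturbation (zdHaar d G) (boxSystem (G := G) ρ n).Adj 𝓕 f ε)
    (hsmall : Real.exp 1 * ε * ((boxDeg d : ℝ) + 1) ^ 2 ≤ 1 / 2)
    (hmeas : ∀ p, Measurable (f p))
    (hdep : ∀ p : BoxLabel n, DependsOn (f p) ((p.bonds : Finset (ZdEdge d)) : Set (ZdEdge d)))
    (i : Fin d)
    (hrot : ∀ (s : ℕ) (p : BoxLabel n) (U : ZdGaugeConfig d G),
      f (BoxLabel.rot i s p) U = f p (U ∘ boxEdgeRot n i s))
    {m : ℕ} (hm : 2 * m ≤ n i) (Q : Finset (Finset (BoxLabel n)) → Prop)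
    (hQ : ∀ (s : ℕ) (𝒞 : Finset (Finset (BoxLabel n))), Q (𝒞.image (Finset.image (BoxLabel.rot i s))) ↔ Q 𝒞) :
    ∑ 𝒞 ∈ ((rconnSubsets (boxSystem (G := G) ρ n).Adj Finset.univ).powerset.filter
        fun 𝒞 => ∑ Y ∈ 𝒞, (Y.card : ℝ) < m) with Q 𝒞,
        truncatedWeight (GeomInc (boxSystem (G := G) ρ n).Adj)
          (connActivity (boxSystem (G := G) ρ n).Adj (zdHaar d G) f) 𝒞 =
      (n i : ℂ) * ∑ 𝒞 ∈ ((rconnSubsets (boxSystem (G := G) ρ n).Adj Finset.univ).powerset.filter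
        fun 𝒞 => ∑ Y ∈ 𝒞, (Y.card : ℝ) < m) with Q 𝒞 ∧ BoxRooted i m 𝒞,
        truncatedWeight (GeomInc (boxSystem (G := G) ρ n).Adj)
          (connActivity (boxSystem (G := G) ρ n).Adj (zdHaar d G) f) 𝒞 := by
  set T := boxSystem (G := G) ρ n with hT
  set L := rconnSubsets T.Adj Finset.univ with hL
  set Sm := L.powerset.filter fun 𝒞 => ∑ Y ∈ 𝒞, (Y.card : ℝ) < m with hSm
  set Φ : Finset (Finset (BoxLabel n)) → ℂ := truncatedWeight (GeomInc T.Adj)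
    (connActivity T.Adj (zdHaar d G) f) with hΦ
  set rotF : ℕ → Finset (Finset (BoxLabel n)) → Finset (Finset (BoxLabel n)) :=
    fun s 𝒞 => 𝒞.image (Finset.image (BoxLabel.rot i s)) with hrotF
  -- the truncated functional vanishes off nonempty clusters
  have hKP : IsKPVolume (GeomInc T.Adj) (connActivity T.Adj (zdHaar d G) f) (fun X => (X.card : ℝ)) L :=
    isKPVolume_connActivity (R := T.Adj) (card_near_boxSystem_le (ρ := ρ)) (fun x y h => T.mem_near x y h)
      hLP hsmall L
  set P : Finset (Finset (BoxLabel n)) → Prop := fun 𝒞 => IsPolymerCluster (GeomInc T.Adj) 𝒞 ∧ 𝒞.Nonempty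
    with hP
  have hΦ0 : ∀ 𝒞 ∈ Sm, ¬ P 𝒞 → Φ 𝒞 = 0 := by
    intro 𝒞 h𝒞 hnP
    have h𝒞L : 𝒞 ⊆ L := Finset.mem_powerset.1 (Finset.mem_filter.1 h𝒞).1
    by_cases hcl : IsPolymerCluster (GeomInc T.Adj) 𝒞
    · have hempty : 𝒞 = ∅ := Finset.not_nonempty_iff_eq_empty.1 fun hne => hnP ⟨hcl, hne⟩
      rw [hempty, hΦ, truncatedWeight_empty]
    · exact truncatedWeight_eq_zero_of_kp hKP h𝒞L hcl
  -- restrict both sums to nonempty clusters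
  have hrestrict : ∀ (R' : Finset (Finset (BoxLabel n)) → Prop) [DecidablePred R'],
      ∑ 𝒞 ∈ Sm with R' 𝒞, Φ 𝒞 = ∑ 𝒞 ∈ (Sm.filter R') with P 𝒞, Φ 𝒞 := by
    intro R' _
    rw [← Finset.sum_filter_add_sum_filter_not (Sm.filter R') P, add_eq_left]
    exact Finset.sum_eq_zero fun 𝒞 h𝒞 => hΦ0 𝒞 (Finset.mem_filter.1 (Finset.mem_filter.1 h𝒞).1).1
      (Finset.mem_filter.1 h𝒞).2
  rw [hrestrict Q, hrestrict fun 𝒞 => Q 𝒞 ∧ BoxRooted i m 𝒞]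
  set A := (Sm.filter Q).filter P with hA
  set Ar := (Sm.filter fun 𝒞 => Q 𝒞 ∧ BoxRooted i m 𝒞).filter P with hAr
  -- invariance of `Sm`, `Q`, `P` under rotations
  have hL_rot : ∀ (s : ℕ) (Y : Finset (BoxLabel n)), Y.image (BoxLabel.rot i s) ∈ L ↔ Y ∈ L :=
    fun s Y => image_rot_mem_rconnSubsets_iff (G := G) (ρ := ρ) i s Y
  have hSm_rot : ∀ (s : ℕ) (𝒞 : Finset (Finset (BoxLabel n))), rotF s 𝒞 ∈ Sm ↔ 𝒞 ∈ Sm := by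
    intro s 𝒞
    simp only [hSm, Finset.mem_filter, Finset.mem_powerset, hrotF, sum_card_rotFamily]
    refine and_congr_left fun _ => ⟨fun h Y hY => ?_, fun h Y' hY' => ?_⟩
    · exact (hL_rot s Y).1 (h (Finset.mem_image_of_mem _ hY))
    · obtain ⟨Y, hY, rfl⟩ := Finset.mem_image.1 hY'
      exact (hL_rot s Y).2 (h hY)
  have hP_rot : ∀ (s : ℕ) (𝒞 : Finset (Finset (BoxLabel n))), P (rotF s 𝒞) ↔ P 𝒞 := by
    intro s 𝒞
    simp only [hP, hrotF, Finset.image_nonempty]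
    exact and_congr_left fun _ => isPolymerCluster_rotFamily_iff (G := G) (ρ := ρ) i s 𝒞
  have hA_rot : ∀ (s : ℕ) (𝒞 : Finset (Finset (BoxLabel n))), rotF s 𝒞 ∈ A ↔ 𝒞 ∈ A := by
    intro s 𝒞
    simp only [hA, Finset.mem_filter, hSm_rot, hP_rot]
    exact and_congr_left fun _ => and_congr_right fun _ => hQ s 𝒞
  -- the bijection `(s, 𝒞₀) ↦ rot i s 𝒞₀` from `Fin (n i) × Ar` onto `A`
  set F : Fin (n i) × Finset (Finset (BoxLabel n)) → Finset (Finset (BoxLabel n)) := fun x => rotF x.1 x.2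
    with hF
  have hArA : Ar ⊆ A := by
    intro 𝒞 h𝒞
    simp only [hAr, hA, Finset.mem_filter] at h𝒞 ⊢
    exact ⟨⟨h𝒞.1.1, h𝒞.1.2.1⟩, h𝒞.2⟩
  have himage : A = (Finset.univ ×ˢ Ar).image F := by
    ext 𝒞
    constructor
    · intro h𝒞
      have h𝒞' := h𝒞
      simp only [hA, Finset.mem_filter, hSm, Finset.mem_powerset] at h𝒞'
      obtain ⟨⟨⟨h𝒞L, hsize⟩, hQ𝒞⟩, hcl, hne⟩ := h𝒞'
      have hconn : ∀ Y ∈ 𝒞, IsRConnected T.Adj Y := fun Y hY => (mem_rconnSubsets.1 (h𝒞L hY)).2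
      obtain ⟨s, hs, hroot⟩ :=
        exists_boxRooted_rotFamily (G := G) (ρ := ρ) i (by omega : m ≤ n i) hne hcl hconn hsize
      refine Finset.mem_image.2 ⟨(⟨s, hs⟩, rotF (n i - s) 𝒞), Finset.mem_product.2 ⟨Finset.mem_univ _, ?_⟩, ?_⟩
      · simp only [hAr, Finset.mem_filter]
        have h1 : rotF (n i - s) 𝒞 ∈ A := (hA_rot _ _).2 h𝒞
        simp only [hA, Finset.mem_filter] at h1
        exact ⟨⟨h1.1.1, h1.1.2, hroot⟩, h1.2⟩
      · show rotF s (rotF (n i - s) 𝒞) = 𝒞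
        simp only [hrotF]
        rw [rotFamily_rotFamily, Nat.add_sub_cancel' hs.le, rotFamily_size]
    · intro h𝒞
      obtain ⟨⟨s, 𝒞₀⟩, hx, rfl⟩ := Finset.mem_image.1 h𝒞
      exact (hA_rot s.1 𝒞₀).2 (hArA (Finset.mem_product.1 hx).2)
  have hinj : Set.InjOn F ((Finset.univ ×ˢ Ar : Finset (Fin (n i) × Finset (Finset (BoxLabel n)))) :
      Set (Fin (n i) × Finset (Finset (BoxLabel n)))) := by
    rintro ⟨s, 𝒞⟩ hx ⟨s', 𝒞'⟩ hx' hxx'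
    have h𝒞 := (Finset.mem_product.1 (Finset.mem_coe.1 hx)).2
    have h𝒞' := (Finset.mem_product.1 (Finset.mem_coe.1 hx')).2
    simp only [hAr, Finset.mem_filter] at h𝒞 h𝒞'
    have hss' : (s : ℕ) = s' :=
      eq_of_rotFamily_eq_of_boxRooted i hm h𝒞.1.2.2 h𝒞'.1.2.2 s.2 s'.2 hxx'
    have hs : s = s' := Fin.ext hss'
    subst hs
    exact Prod.ext rfl (rotFamily_injective i s hxx')
  have hterm : ∀ (s : Fin (n i)) (𝒞 : Finset (Finset (BoxLabel n))), Φ (F (s, 𝒞)) = Φ 𝒞 :=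
    fun s 𝒞 => truncatedWeight_rotFamily_of_covariant (ρ := ρ) hmeas hdep i s.1 (hrot s.1) 𝒞
  rw [himage, Finset.sum_image hinj, Finset.sum_product,
    Finset.sum_congr rfl fun s _ => Finset.sum_congr rfl fun 𝒞 _ => hterm s 𝒞, Finset.sum_const,
    Finset.card_univ, Fintype.card_fin, nsmul_eq_mul]

end SumIdentity

/-! ## §2 Rooted small clusters do not see the size of the box -/

section Inclusion

variable {f : BoxLabel n → ZdGaugeConfig d G → ℂ} {f' : BoxLabel n' → ZdGaugeConfig d G → ℂ}

open scoped Classical in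
/-- **Rooted small clusters and their truncated functionals agree across box sizes** (general factors).  Let `n ≤ n'` be
sizes agreeing outside the set of directions `J` and with `m + 1 ≤ nᵢ` for `i ∈ J`, and let the factor families `f` (box
`n`) and `f'` (box `n'`) be measurable, depending only on the bonds of their labels, and COMPATIBLE WITH THE INCLUSION on the
labels whose `J`-coordinates are `< m`: `f' (castLE p) = f p`.  Then the sums of truncated functionals over the families of
polymers of total size `< m` rooted in every direction of `J` coincide for the two boxes (along `BoxLabel.castLE` such
families keep their bonds, factors, activities, connectedness, cluster structure and `Φ^T`; general-factor form of the
tree's `sum_small_boxRooted_eq_of_le`). [Seiler LNP 159 Ch. 2] -/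
theorem sum_small_boxRooted_eq_of_le_of_compatible (h : ∀ i, n i ≤ n' i) (J : Finset (Fin d))
    (hJ : ∀ i, i ∉ J → n i = n' i) {m : ℕ} (hm : ∀ i ∈ J, m + 1 ≤ n i) (hn : ∀ i, 0 < n i)
    (hmeas : ∀ p, Measurable (f p))
    (hdep : ∀ p : BoxLabel n, DependsOn (f p) ((p.bonds : Finset (ZdEdge d)) : Set (ZdEdge d)))
    (hcompat : ∀ p : BoxLabel n, (∀ j ∈ J, BoxLabel.coord j p < m) →
      ∀ U : ZdGaugeConfig d G, f' (BoxLabel.castLE h p) U = f p U) :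
    ∑ 𝒞 ∈ ((rconnSubsets (boxSystem (G := G) ρ n).Adj Finset.univ).powerset.filter
        fun 𝒞 => ∑ Y ∈ 𝒞, (Y.card : ℝ) < m) with ∀ j ∈ J, BoxRooted j m 𝒞,
        truncatedWeight (GeomInc (boxSystem (G := G) ρ n).Adj)
          (connActivity (boxSystem (G := G) ρ n).Adj (zdHaar d G) f) 𝒞 =
      ∑ 𝒞 ∈ ((rconnSubsets (boxSystem (G := G) ρ n').Adj Finset.univ).powerset.filter
        fun 𝒞 => ∑ Y ∈ 𝒞, (Y.card : ℝ) < m) with ∀ j ∈ J, BoxRooted j m 𝒞,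
        truncatedWeight (GeomInc (boxSystem (G := G) ρ n').Adj)
          (connActivity (boxSystem (G := G) ρ n').Adj (zdHaar d G) f') 𝒞 := by
  set T := boxSystem (G := G) ρ n with hT
  set T' := boxSystem (G := G) ρ n' with hT'
  set Φ : Finset (Finset (BoxLabel n)) → ℂ := truncatedWeight (GeomInc T.Adj)
    (connActivity T.Adj (zdHaar d G) f) with hΦ
  set Φ' : Finset (Finset (BoxLabel n')) → ℂ := truncatedWeight (GeomInc T'.Adj)
    (connActivity T'.Adj (zdHaar d G) f') with hΦ'
  set A : Finset (BoxLabel n) := Finset.univ.filter fun p => ∀ j ∈ J, BoxLabel.coord j p < m with hA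
  set cast : BoxLabel n → BoxLabel n' := BoxLabel.castLE h with hcast
  set castF : Finset (Finset (BoxLabel n)) → Finset (Finset (BoxLabel n')) :=
    fun 𝒞 => 𝒞.image (Finset.image cast) with hcastF
  -- the hypotheses of the local isomorphism along `cast` on `A`, with the identity relabelling
  have h1 : ∀ p ∈ A, T'.bonds (cast p) = (T.bonds p).image id := by
    intro p hp
    rw [Finset.image_id]
    exact BoxLabel.bonds_castLE h hJ hm (Finset.mem_filter.1 hp).2
  have h2 : Set.InjOn (id : ZdEdge d → ZdEdge d) (↑(A.biUnion T.bonds) : Set (ZdEdge d)) := Set.injOn_id _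
  have h3 : ∀ p ∈ A, ∀ U : ZdGaugeConfig d G, f' (cast p) U = f p (U ∘ id) := by
    intro p hp U
    rw [Function.comp_id]
    exact hcompat p (Finset.mem_filter.1 hp).2 U
  have h4 : Set.InjOn cast A := (BoxLabel.castLE_injective h).injOn
  -- families supported in `A`: transport of everything
  have hmemA : ∀ {𝒞 : Finset (Finset (BoxLabel n))}, (∀ j ∈ J, BoxRooted j m 𝒞) → ∀ Y ∈ 𝒞, Y ⊆ A :=
    fun hroot Y hY p hp => Finset.mem_filter.2 ⟨Finset.mem_univ _, fun j hj => (hroot j hj).1 Y hY p hp⟩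
  have hrootF : ∀ (𝒞 : Finset (Finset (BoxLabel n))) (j : Fin d),
      BoxRooted j m (castF 𝒞) ↔ BoxRooted j m 𝒞 := by
    intro 𝒞 j
    unfold BoxRooted
    constructor
    · rintro ⟨ha, Y', hY', p', hp', h0⟩
      obtain ⟨Y, hY, rfl⟩ := Finset.mem_image.1 hY'
      obtain ⟨p, hp, rfl⟩ := Finset.mem_image.1 hp'
      refine ⟨fun Y hY p hp => ?_, Y, hY, p, hp, h0⟩
      exact ha _ (Finset.mem_image_of_mem _ hY) _ (Finset.mem_image_of_mem _ hp)
    · rintro ⟨ha, Y, hY, p, hp, h0⟩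
      refine ⟨fun Y' hY' p' hp' => ?_, Y.image cast, Finset.mem_image_of_mem _ hY, cast p,
        Finset.mem_image_of_mem _ hp, h0⟩
      obtain ⟨Y, hY, rfl⟩ := Finset.mem_image.1 hY'
      obtain ⟨p, hp, rfl⟩ := Finset.mem_image.1 hp'
      exact ha Y hY p hp
  have hSmF : ∀ {𝒞 : Finset (Finset (BoxLabel n))}, (∀ Y ∈ 𝒞, Y ⊆ A) →
      (castF 𝒞 ∈ (rconnSubsets T'.Adj Finset.univ).powerset.filter
          (fun 𝒞 => ∑ Y ∈ 𝒞, (Y.card : ℝ) < m) ↔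
        𝒞 ∈ (rconnSubsets T.Adj Finset.univ).powerset.filter fun 𝒞 => ∑ Y ∈ 𝒞, (Y.card : ℝ) < m) := by
    intro 𝒞 h𝒞A
    simp only [Finset.mem_filter, Finset.mem_powerset, hcastF, PlaqSystem.sum_card_image_image h4 h𝒞A]
    refine and_congr_left fun _ => ⟨fun hs Y hY => ?_, fun hs Y' hY' => ?_⟩
    · have hY' := hs (Finset.mem_image_of_mem _ hY)
      rw [PlaqSystem.mem_rconnSubsets_image_iff h1 h2 h4 (h𝒞A Y hY) (Finset.subset_univ _)] at hY'
      exact mem_rconnSubsets.2 ⟨Finset.subset_univ _, hY'⟩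
    · obtain ⟨Y, hY, rfl⟩ := Finset.mem_image.1 hY'
      rw [PlaqSystem.mem_rconnSubsets_image_iff h1 h2 h4 (h𝒞A Y hY) (Finset.subset_univ _)]
      exact (mem_rconnSubsets.1 (hs hY)).2
  have hΦF : ∀ {𝒞 : Finset (Finset (BoxLabel n))}, (∀ Y ∈ 𝒞, Y ⊆ A) → Φ' (castF 𝒞) = Φ 𝒞 :=
    fun h𝒞A => truncatedWeight_image_image_eq_of_transport h1 h2 h3 h4 hmeas hdep h𝒞A
  -- the right-hand index set is the image of the left-hand one
  set B := ((rconnSubsets T.Adj Finset.univ).powerset.filter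
      fun 𝒞 => ∑ Y ∈ 𝒞, (Y.card : ℝ) < m).filter fun 𝒞 => ∀ j ∈ J, BoxRooted j m 𝒞 with hB
  set B' := ((rconnSubsets T'.Adj Finset.univ).powerset.filter
      fun 𝒞 => ∑ Y ∈ 𝒞, (Y.card : ℝ) < m).filter fun 𝒞 => ∀ j ∈ J, BoxRooted j m 𝒞 with hB'
  -- the partial inverse on labels with all coordinates below `n`
  set down : BoxLabel n' → BoxLabel n :=
    fun p' => (fun j => ⟨((p'.1 j : ℕ)) % n j, Nat.mod_lt _ (hn j)⟩, p'.2) with hdown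
  have hcast_down : ∀ p' : BoxLabel n', (∀ j, BoxLabel.coord j p' < n j) → cast (down p') = p' := by
    intro p' hp'
    refine Prod.ext (funext fun j => Fin.ext ?_) rfl
    simp only [hcast, BoxLabel.castLE, BoxSite.castLE, Fin.val_castLE, hdown]
    exact Nat.mod_eq_of_lt (hp' j)
  have himage : B' = B.image castF := by
    ext 𝒞'
    constructor
    · intro h𝒞'
      obtain ⟨h𝒞'S, hroot'⟩ := Finset.mem_filter.1 h𝒞'
      -- all coordinates of the labels of `𝒞'` are below `n`
      have hsmall' : ∀ Y' ∈ 𝒞', ∀ p' ∈ Y', ∀ j, BoxLabel.coord j p' < n j := by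
        intro Y' hY' p' hp' j
        by_cases hj : j ∈ J
        · exact lt_of_lt_of_le ((hroot' j hj).1 Y' hY' p' hp') (by have := hm j hj; omega)
        · rw [hJ j hj]; exact BoxLabel.coord_lt j p'
      set 𝒞 := 𝒞'.image (Finset.image down) with h𝒞
      have hcastF𝒞 : castF 𝒞 = 𝒞' := by
        simp only [hcastF, h𝒞, Finset.image_image]
        conv_rhs => rw [← Finset.image_id (s := 𝒞')]
        refine Finset.image_congr fun Y' hY' => ?_
        simp only [Function.comp_apply, Finset.image_image, id]
        conv_rhs => rw [← Finset.image_id (s := Y')]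
        exact Finset.image_congr fun p' hp' => by
          simpa using hcast_down p' (hsmall' Y' (Finset.mem_coe.1 hY') p' (Finset.mem_coe.1 hp'))
      have h𝒞A : ∀ Y ∈ 𝒞, Y ⊆ A := by
        intro Y hY p hp
        obtain ⟨Y', hY', rfl⟩ := Finset.mem_image.1 hY
        obtain ⟨p', hp', rfl⟩ := Finset.mem_image.1 hp
        refine Finset.mem_filter.2 ⟨Finset.mem_univ _, fun j hj => ?_⟩
        have hc : BoxLabel.coord j (down p') = BoxLabel.coord j p' := by
          simp only [BoxLabel.coord, hdown]
          exact Nat.mod_eq_of_lt (hsmall' Y' hY' p' hp' j)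
        rw [hc]
        exact (hroot' j hj).1 Y' hY' p' hp'
      refine Finset.mem_image.2 ⟨𝒞, Finset.mem_filter.2 ⟨?_, fun j hj => ?_⟩, hcastF𝒞⟩
      · exact (hSmF h𝒞A).1 (hcastF𝒞 ▸ h𝒞'S)
      · exact (hrootF 𝒞 j).1 (hcastF𝒞 ▸ hroot' j hj)
    · intro h𝒞'
      obtain ⟨𝒞, h𝒞B, rfl⟩ := Finset.mem_image.1 h𝒞'
      obtain ⟨h𝒞S, hroot⟩ := Finset.mem_filter.1 h𝒞B
      exact Finset.mem_filter.2 ⟨(hSmF (hmemA hroot)).2 h𝒞S, fun j hj => (hrootF 𝒞 j).2 (hroot j hj)⟩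
  have hinj : Set.InjOn castF (B : Set (Finset (Finset (BoxLabel n)))) :=
    (Finset.image_injective (Finset.image_injective (BoxLabel.castLE_injective h))).injOn
  rw [himage, Finset.sum_image hinj]
  exact Finset.sum_congr rfl fun 𝒞 h𝒞 => (hΦF (hmemA (Finset.mem_filter.1 h𝒞).2)).symm

end Inclusion

end Summit.QuantumFields.YangMills.Cruxes.IR.PurityChannelFamily

end
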